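import Literature.MathematicalPhysics.KineticTheory.HardSphereWindowPressureStatic
import Summits.AtomisticToContinuum.HydrodynamicLimit.Theorems.TwoClocksEquilibriumShearWindowLDStatic

/-!
# Stub `stub_staticReduction` of the line `Sketch` (doubling RG) for the crux
`TwoClocks.EquilibriumFastWindowLD` (stmt-AtomisticToContinuum-14440)

Static reduction (glue of two landed statics): under the homogeneous (constant-profile) Gibbs law
`G_N = localGibbsLaw σ a₀ u₀ θ₀ N Φ` with `σ ≤ 1/2`, a one-site bound
`∫⁻ exp(β F(x, ·)) dN(u₀, θ₀ id) ≤ exp(K β²)`, uniform in the position `x`, gives the quadratic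
static seed for the crux's window exponential moment
`M_N(β, τ) = ∫⁻ exp(β ∑ᵢ w⁻¹ ∫₀ʷ F((Φ_r z)ᵢ) dr) dG_N ≤ exp(K β² (N+1))`, `w = τ (N+1)^{-1/3}`,
for every window `τ > 0`, every `N` and every flow `Φ`:

* Jensen in time + flow-invariance of `G_N` (`lintegral_exp_windowSum_le_static`): the window
  moment is dominated by the static one, `∫⁻ exp(β ∑ᵢ F(zᵢ)) dG_N`;
* Gaussian one-site factorisation (`lintegral_exp_sum_localGibbsMeasure_const_le`, after
  `localGibbsLaw_eq`): given the positions the velocities are i.i.d. `N(u₀, θ₀ id)`, so the static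
  moment is at most `(exp(K β²))^{N+1} = exp(K β² (N+1))`.
-/

noncomputable section

open MeasureTheory ProbabilityTheory Real Set Filter
open scoped ENNReal BigOperators

namespace Summit.AtomisticToContinuum.HydrodynamicLimit.Theorems.FastWindowRG

open Literature.Analysis.FluidPDE Literature.MathematicalPhysics.KineticTheory

/-- **S3 `stub_staticReduction`** (glue of landed statics). Under the homogeneous Gibbs law
(`σ ≤ 1/2`), a one-site bound `∫⁻ exp(β F(x, ·)) dN(u₀, θ₀ id) ≤ exp(Kβ²)` uniform in `x` gives
`M_N(β, τ) ≤ exp(Kβ²(N+1))` for every window `τ > 0`, every `N` and every flow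
(`lintegral_exp_windowSum_le_static` + `lintegral_exp_sum_localGibbsMeasure_const_le`). -/
theorem stub_staticReduction {a₀ θ₀ : ℝ} (ha : 0 < a₀) (hθ : 0 < θ₀) (u₀ : V3) {σ : ℝ}
    (hσ2 : σ ≤ 1 / 2) (N : ℕ)
    (Φ : HardSphereFlow (Torus.geometry (Fin 3)) (hsDiameter σ N) (N + 1))
    {F : T3 × V3 → ℝ} (hF : Continuous F) {β K : ℝ}
    (hone : ∀ x : T3, ∫⁻ v, ENNReal.ofReal (Real.exp (β * F (x, v))) ∂(gaussMeasure u₀ θ₀) ≤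
      ENNReal.ofReal (Real.exp (K * β ^ 2)))
    {τ : ℝ} (hτ : 0 < τ) :
    ∫⁻ z, ENNReal.ofReal (Real.exp (β * ∑ i : Fin (N + 1),
        (τ * ((N : ℝ) + 1) ^ (-(1 / 3 : ℝ)))⁻¹ *
          ∫ r in (0 : ℝ)..(τ * ((N : ℝ) + 1) ^ (-(1 / 3 : ℝ))), F (((Φ).flow r z) i)))
      ∂(localGibbsLaw σ (fun _ => a₀) (fun _ => u₀) (fun _ => θ₀) N Φ) ≤
      ENNReal.ofReal (Real.exp (K * β ^ 2 * ((N : ℝ) + 1))) := by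
  -- the window is positive
  have hw : 0 < τ * ((N : ℝ) + 1) ^ (-(1 / 3 : ℝ)) :=
    mul_pos hτ (Real.rpow_pos_of_pos (by positivity) _)
  -- the tilted one-body observable is measurable
  have hq : Measurable fun y : T3 × V3 => β * F y := hF.measurable.const_mul β
  -- Step 1: Jensen in time + invariance (window moment ≤ static moment)
  refine (lintegral_exp_windowSum_le_static σ a₀ θ₀ u₀ N Φ hF β hw).trans ?_
  -- Step 2: Gaussian one-site factorisation of the static moment
  have hstatic : ∫⁻ z, ENNReal.ofReal (Real.exp (∑ i, β * F (z i)))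
      ∂(localGibbsMeasure σ (fun _ => a₀) (fun _ => u₀) (fun _ => θ₀) N) ≤
      ENNReal.ofReal (Real.exp (K * β ^ 2)) ^ (N + 1) :=
    lintegral_exp_sum_localGibbsMeasure_const_le ha hθ u₀ hσ2 N hq hone
  -- assemble: `β ∑ F = ∑ β F`, the law is the measure, and `exp(Kβ²)^(N+1) = exp(Kβ²(N+1))`
  have hpow : ENNReal.ofReal (Real.exp (K * β ^ 2)) ^ (N + 1) =
      ENNReal.ofReal (Real.exp (K * β ^ 2 * ((N : ℝ) + 1))) := by
    rw [← ENNReal.ofReal_pow (Real.exp_pos _).le, ← Real.exp_nat_mul]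
    push_cast
    ring_nf
  calc ∫⁻ z, ENNReal.ofReal (Real.exp (β * ∑ i, F (z i)))
        ∂(localGibbsLaw σ (fun _ => a₀) (fun _ => u₀) (fun _ => θ₀) N Φ)
      = ∫⁻ z, ENNReal.ofReal (Real.exp (∑ i, β * F (z i)))
        ∂(localGibbsMeasure σ (fun _ => a₀) (fun _ => u₀) (fun _ => θ₀) N) := by
        rw [localGibbsLaw_eq]
        simp_rw [Finset.mul_sum]
    _ ≤ ENNReal.ofReal (Real.exp (K * β ^ 2)) ^ (N + 1) := hstatic
    _ = ENNReal.ofReal (Real.exp (K * β ^ 2 * ((N : ℝ) + 1))) := hpow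

end Summit.AtomisticToContinuum.HydrodynamicLimit.Theorems.FastWindowRG

end
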